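import Literature.Analysis.FluidPDE.LocalLerayInitialPairing
import Literature.Analysis.FluidPDE.CKNTenThirdsInterpolation
import Literature.Analysis.FluidPDE.SuitableWeakSliced
import Literature.Analysis.FluidPDE.SuitableWeakRescaling
import HarnessLib

/-!
# Local Leray solutions near the initial time, II: the local energy inequality from `t = 0`

Analysis/FluidPDE proofs file (no new definitions), second of two files serving the proof of
the named fact `bradshawTsai2019_limitDatum` (`ForwardDSSCylinderLimitParts.lean`: continuity of
the limit of local Leray solutions at `t = 0` in local `L²`; Bradshaw–Tsai, Analysis & PDE 12
(2019) = arXiv:1801.08060, §4.3; Lemarié-Rieusset 2016, Prop. 14.1). This file supplies the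
**energy** half, for one solution, and the uniform integrability that drives it:

* `lintegral_tenThirds_cylinder_le`, `exists_uniform_tenThirds_bound` — the local Lebesgue
  interpolation `L^∞L² ∩ L²H¹ ⊂ L^{10/3}` (accepted `exists_lintegral_tenThirds_backward_le`,
  Lemarié-Rieusset 2016, (13.18)) on the forward cylinders `(0, ρ²) × B_ρ(x₀) ⊆ (0,T) × B₁`, and
  its sum over a finite cover: for a family `v_k` with `esssup_t ∫_{B₁}|v_k|² ≤ C`,
  `∫∫_{(0,T)×B₁}|∇v_k|² ≤ C` and every `r < 1` there are `T₀ > 0` and `M < ∞` with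
  `∫∫_{(0,T₀)×B_r} |v_k|^{10/3} ≤ M` for all `k`;
* `exists_ae_abs_integral_sq_mul_sub_le` — `∫|u(t)|²ψ → ∫|u₀|²ψ` (a.e. form) when `u(t) → u₀`
  in `L²(K)`;
* `IsLocalLeraySolution.ae_lintegral_sq_mul_le_datum_add` — **the local energy inequality from
  the initial time at a.e. slice**: for a local Leray solution `(v, π)` with measurable datum
  `v₀`, `ψ ≥ 0` smooth with `tsupport ψ ⊆ B_r` and `|v|³ ∈ L¹((0,T₀) × B_r)`, for a.e.
  `s ∈ (0, T₀/2)`,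
  `∫|v(s)|²ψ ≤ ∫|v₀|²ψ + ∫∫_{(0,s)×B_r} | |v|²Δψ + (|v|² + 2π) v·∇ψ |`
  (the accepted sliced inequality `ae_localEnergy_slice_ennreal`, CKN (2.5), tested with
  `η_δ(t) θ(t) ψ(x)` and `δ → 0` through the initial condition; Lemarié-Rieusset 2016,
  Prop. 14.1: "`limsup_{t→0} ∫|u(t)|²φ ≤ ∫|u₀|²φ`").

## References

* P. G. Lemarié-Rieusset, *The Navier–Stokes Problem in the 21st Century*, CRC Press (2016),
  Prop. 14.1, (13.18) [LemarieRieusset2016].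
* L. Caffarelli, R. Kohn, L. Nirenberg, Comm. Pure Appl. Math. 35 (1982), §2 (2.5)
  [CaffarelliKohnNirenberg1982].
* Z. Bradshaw, T.-P. Tsai, Analysis & PDE 12 (2019) = arXiv:1801.08060, §4.3 [BradshawTsai2019].
-/

noncomputable section

open MeasureTheory TopologicalSpace Set Function Filter Topology Metric
open scoped ENNReal NNReal RealInnerProductSpace Laplacian

namespace Literature.Analysis.FluidPDE

namespace BradshawTsai2019

section TenThirds

/-- **Uniform local `L^{10/3}` bound near `t = 0`.** If `v` has a weak spatial gradient `G` on
the slab `(0,∞) × ℝ³` with `esssup_{0<t<T} ∫_{B₁} |v(t)|² ≤ C` and `∫∫_{(0,T)×B₁} |∇v|² ≤ C`,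
then for every ball `B_ρ(x₀) ⊆ B₁` with `ρ² ≤ T`,
`∫∫_{(0,ρ²)×B_ρ(x₀)} |v|^{10/3} ≤ K ρ^{5/3} (C/ρ)^{2/3} · 2C/ρ` (`K` absolute): the local Lebesgue
interpolation `L^∞L² ∩ L²H¹ ⊂ L^{10/3}` on the backward parabolic cylinder
`Q_ρ(ρ², x₀) = (0, ρ²) × B_ρ(x₀)` (`exists_lintegral_tenThirds_backward_le`; Lemarié-Rieusset
2016, (13.18)). [cite: LemarieRieusset2016, §13.9 p. 468] -/
theorem lintegral_tenThirds_cylinder_le {K : ℝ≥0}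
    (hK : ∀ (u : ℝ → EuclideanSpace ℝ (Fin 3) → EuclideanSpace ℝ (Fin 3))
      (G : ℝ → EuclideanSpace ℝ (Fin 3) → EuclideanSpace ℝ (Fin 3) →L[ℝ] EuclideanSpace ℝ (Fin 3))
      (z : ℝ × EuclideanSpace ℝ (Fin 3)) (r : ℝ), 0 < r →
      HasWeakSpatialGradientOn (parabolicCylinderOpens r z) u G →
      cknAEss r z u ≠ ∞ → cknE r z G ≠ ∞ →
      ∫⁻ q in parabolicCylinder r z, ‖u q.1 q.2‖ₑ ^ (10 / 3 : ℝ) ≤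
        K * ENNReal.ofReal (r ^ (5 / 3 : ℝ)) * cknAEss r z u ^ (2 / 3 : ℝ) *
          (cknAEss r z u + cknE r z G))
    {v : ℝ → EuclideanSpace ℝ (Fin 3) → EuclideanSpace ℝ (Fin 3)}
    {G : ℝ → EuclideanSpace ℝ (Fin 3) → EuclideanSpace ℝ (Fin 3) →L[ℝ] EuclideanSpace ℝ (Fin 3)}
    {T : ℝ} {C : ℝ≥0}
    (hG : HasWeakSpatialGradientOn (slab (EuclideanSpace ℝ (Fin 3)) (Ioi 0) isOpen_Ioi) v G)
    (hE : ∀ᵐ t ∂(volume.restrict (Ioo 0 T)),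
      ∫⁻ x in ball (0 : EuclideanSpace ℝ (Fin 3)) 1, ‖v t x‖ₑ ^ 2 ≤ C)
    (hGb : ∫⁻ z in Ioo 0 T ×ˢ ball (0 : EuclideanSpace ℝ (Fin 3)) 1,
      ENNReal.ofReal (frobeniusNormSq (G z.1 z.2)) ≤ C)
    {x₀ : EuclideanSpace ℝ (Fin 3)} {ρ : ℝ} (hρ : 0 < ρ) (hρT : ρ ^ 2 ≤ T)
    (hB : ball x₀ ρ ⊆ ball 0 1) :
    ∫⁻ z in Ioo 0 (ρ ^ 2) ×ˢ ball x₀ ρ, ‖v z.1 z.2‖ₑ ^ (10 / 3 : ℝ) ≤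
      K * ENNReal.ofReal (ρ ^ (5 / 3 : ℝ)) * ((ENNReal.ofReal ρ)⁻¹ * C) ^ (2 / 3 : ℝ) *
        ((ENNReal.ofReal ρ)⁻¹ * C + (ENNReal.ofReal ρ)⁻¹ * C) := by
  set z₀ : ℝ × EuclideanSpace ℝ (Fin 3) := (ρ ^ 2, x₀) with hz₀
  have hcyl : parabolicCylinder ρ z₀ = Ioo 0 (ρ ^ 2) ×ˢ ball x₀ ρ := by
    simp [parabolicCylinder, hz₀]
  -- the cylinder lies in the slab
  have hle : (parabolicCylinderOpens ρ z₀ : Opens (ℝ × EuclideanSpace ℝ (Fin 3))) ≤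
      slab (EuclideanSpace ℝ (Fin 3)) (Ioi 0) isOpen_Ioi := by
    intro z hz
    have hz' : z ∈ parabolicCylinder ρ z₀ := hz
    rw [hcyl] at hz'
    exact mem_slab.2 hz'.1.1
  have hG' : HasWeakSpatialGradientOn (parabolicCylinderOpens ρ z₀) v G := hG.mono hle
  -- the two scaled quantities
  have hA : cknAEss ρ z₀ v ≤ (ENNReal.ofReal ρ)⁻¹ * C := by
    have hI : Ioo (z₀.1 - ρ ^ 2) z₀.1 = Ioo 0 (ρ ^ 2) := by simp [hz₀]
    simp only [cknAEss, hI]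
    refine essSup_le_of_ae_le _ ?_
    have hE' : ∀ᵐ t ∂(volume.restrict (Ioo 0 (ρ ^ 2))),
        ∫⁻ x in ball (0 : EuclideanSpace ℝ (Fin 3)) 1, ‖v t x‖ₑ ^ 2 ≤ C :=
      ae_restrict_of_ae_restrict_of_subset (Ioo_subset_Ioo_right hρT) hE
    filter_upwards [hE'] with t ht
    exact mul_le_mul_right ((lintegral_mono_set hB).trans ht) _
  have hEq : cknE ρ z₀ G ≤ (ENNReal.ofReal ρ)⁻¹ * C := by
    simp only [cknE, hcyl]
    refine mul_le_mul_right (le_trans (lintegral_mono_set ?_) hGb) _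
    exact prod_mono (Ioo_subset_Ioo_right hρT) hB
  have hAfin : cknAEss ρ z₀ v ≠ ∞ :=
    ne_top_of_le_ne_top (ENNReal.mul_ne_top (ENNReal.inv_ne_top.2
      (ENNReal.ofReal_pos.2 hρ).ne') ENNReal.coe_ne_top) hA
  have hEfin : cknE ρ z₀ G ≠ ∞ :=
    ne_top_of_le_ne_top (ENNReal.mul_ne_top (ENNReal.inv_ne_top.2
      (ENNReal.ofReal_pos.2 hρ).ne') ENNReal.coe_ne_top) hEq
  have key := hK v G z₀ ρ hρ hG' hAfin hEfin
  rw [hcyl] at key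
  refine key.trans ?_
  gcongr

/-- `∫⁻` over a finite union is at most the sum of the `∫⁻` over the pieces. [folklore] -/
theorem lintegral_biUnion_finset_le {α ι : Type*} [MeasurableSpace α] (μ : Measure α)
    (s : Finset ι) (t : ι → Set α) (f : α → ℝ≥0∞) :
    ∫⁻ a in ⋃ i ∈ s, t i, f a ∂μ ≤ ∑ i ∈ s, ∫⁻ a in t i, f a ∂μ := by
  classical
  induction s using Finset.induction_on with
  | empty => simp
  | insert a s ha ih =>
    rw [Finset.set_biUnion_insert, Finset.sum_insert ha]
    exact (lintegral_union_le _ _ _).trans (add_le_add le_rfl ih)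

/-- **Uniform `L^{10/3}` bound on an initial layer, for a family.** Let `v_k` have weak
spatial gradients `G_k` on the slab `(0,∞) × ℝ³` with `esssup_{0<t<T} ∫_{B₁}|v_k(t)|² ≤ C` and
`∫∫_{(0,T)×B₁}|∇v_k|² ≤ C` uniformly in `k` (`T > 0`). Then for every `r < 1` there are a height
`0 < T₀ ≤ T` and a finite `M` with `∫∫_{(0,T₀)×B_r} |v_k|^{10/3} ≤ M` for all `k`: cover `B̄_r`
by finitely many balls `B_ρ(x_i) ⊆ B₁`, `ρ = min((1-r)/2, √T)`, `T₀ = ρ²`, and add up the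
bounds of `lintegral_tenThirds_cylinder_le` (Lemarié-Rieusset 2016, (13.18)). [cite: LemarieRieusset2016, §13.9 p. 468] -/
theorem exists_uniform_tenThirds_bound
    {v : ℕ → ℝ → EuclideanSpace ℝ (Fin 3) → EuclideanSpace ℝ (Fin 3)} {T : ℝ} {C : ℝ≥0}
    (hT : 0 < T)
    (hE : ∀ k, ∀ᵐ t ∂(volume.restrict (Ioo 0 T)),
      ∫⁻ x in ball (0 : EuclideanSpace ℝ (Fin 3)) 1, ‖v k t x‖ₑ ^ 2 ≤ C)
    (hG : ∀ k, ∃ G : ℝ → EuclideanSpace ℝ (Fin 3) →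
        EuclideanSpace ℝ (Fin 3) →L[ℝ] EuclideanSpace ℝ (Fin 3),
      HasWeakSpatialGradientOn (slab (EuclideanSpace ℝ (Fin 3)) (Ioi 0) isOpen_Ioi) (v k) G ∧
      ∫⁻ z in Ioo 0 T ×ˢ ball (0 : EuclideanSpace ℝ (Fin 3)) 1,
        ENNReal.ofReal (frobeniusNormSq (G z.1 z.2)) ≤ C)
    {r : ℝ} (hr : r < 1) :
    ∃ T₀ : ℝ, 0 < T₀ ∧ T₀ ≤ T ∧ ∃ M : ℝ≥0∞, M < ⊤ ∧
      ∀ k, ∫⁻ z in Ioo 0 T₀ ×ˢ ball (0 : EuclideanSpace ℝ (Fin 3)) r,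
        ‖v k z.1 z.2‖ₑ ^ (10 / 3 : ℝ) ≤ M := by
  obtain ⟨K, hK⟩ := exists_lintegral_tenThirds_backward_le
  -- the radius and the height
  set ρ : ℝ := min ((1 - r) / 2) (Real.sqrt T) with hρdef
  have hρ0 : 0 < ρ := lt_min (by linarith) (Real.sqrt_pos.2 hT)
  have hρr : ρ ≤ (1 - r) / 2 := min_le_left _ _
  have hρT : ρ ^ 2 ≤ T := by
    calc ρ ^ 2 ≤ Real.sqrt T ^ 2 := by gcongr; exact min_le_right _ _
      _ = T := Real.sq_sqrt hT.le
  -- the finite cover of `B̄_r`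
  obtain ⟨t, htK, htfin, hcov⟩ :=
    finite_cover_balls_of_compact (isCompact_closedBall (0 : EuclideanSpace ℝ (Fin 3)) r) hρ0
  have hballs : ∀ x ∈ t, ball x ρ ⊆ ball (0 : EuclideanSpace ℝ (Fin 3)) 1 := by
    intro x hx y hy
    have hx' : ‖x‖ ≤ r := by simpa using htK hx
    rw [mem_ball, dist_eq_norm] at hy
    rw [mem_ball_zero_iff]
    calc ‖y‖ = ‖(y - x) + x‖ := by rw [sub_add_cancel]
      _ ≤ ‖y - x‖ + ‖x‖ := norm_add_le _ _
      _ < ρ + r := add_lt_add_of_lt_of_le hy hx'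
      _ ≤ (1 - r) / 2 + r := by linarith
      _ < 1 := by linarith
  set B : ℝ≥0∞ := K * ENNReal.ofReal (ρ ^ (5 / 3 : ℝ)) * ((ENNReal.ofReal ρ)⁻¹ * C) ^ (2 / 3 : ℝ) *
      ((ENNReal.ofReal ρ)⁻¹ * C + (ENNReal.ofReal ρ)⁻¹ * C) with hB
  have hinv : (ENNReal.ofReal ρ)⁻¹ ≠ ⊤ := ENNReal.inv_ne_top.2 (ENNReal.ofReal_pos.2 hρ0).ne'
  have hBfin : B < ⊤ := by
    have h1 : (ENNReal.ofReal ρ)⁻¹ * C ≠ ⊤ := ENNReal.mul_ne_top hinv ENNReal.coe_ne_top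
    exact ENNReal.mul_lt_top (ENNReal.mul_lt_top
      (ENNReal.mul_lt_top ENNReal.coe_lt_top ENNReal.ofReal_lt_top)
      (ENNReal.rpow_lt_top_of_nonneg (by norm_num) h1))
      (ENNReal.add_lt_top.2 ⟨h1.lt_top, h1.lt_top⟩)
  refine ⟨ρ ^ 2, by positivity, hρT, (∑ x ∈ htfin.toFinset, B), ?_, fun k => ?_⟩
  · exact ENNReal.sum_lt_top.2 fun _ _ => hBfin
  · obtain ⟨G, hGk, hGb⟩ := hG k
    have hsub : Ioo 0 (ρ ^ 2) ×ˢ ball (0 : EuclideanSpace ℝ (Fin 3)) r ⊆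
        ⋃ x ∈ htfin.toFinset, Ioo 0 (ρ ^ 2) ×ˢ ball x ρ := by
      intro z hz
      have hz2 : z.2 ∈ closedBall (0 : EuclideanSpace ℝ (Fin 3)) r := ball_subset_closedBall hz.2
      obtain ⟨x, hx, hzx⟩ := mem_iUnion₂.1 (hcov hz2)
      exact mem_iUnion₂.2 ⟨x, htfin.mem_toFinset.2 hx, hz.1, hzx⟩
    calc ∫⁻ z in Ioo 0 (ρ ^ 2) ×ˢ ball (0 : EuclideanSpace ℝ (Fin 3)) r,
          ‖v k z.1 z.2‖ₑ ^ (10 / 3 : ℝ)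
        ≤ ∫⁻ z in ⋃ x ∈ htfin.toFinset, Ioo 0 (ρ ^ 2) ×ˢ ball x ρ,
            ‖v k z.1 z.2‖ₑ ^ (10 / 3 : ℝ) := lintegral_mono_set hsub
      _ ≤ ∑ x ∈ htfin.toFinset, ∫⁻ z in Ioo 0 (ρ ^ 2) ×ˢ ball x ρ,
            ‖v k z.1 z.2‖ₑ ^ (10 / 3 : ℝ) := lintegral_biUnion_finset_le _ _ _ _
      _ ≤ ∑ x ∈ htfin.toFinset, B := Finset.sum_le_sum fun x hx =>
          lintegral_tenThirds_cylinder_le hK hGk (hE k) hGb hρ0 hρT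
            (hballs x (htfin.mem_toFinset.1 hx))

end TenThirds

section Energy

variable {E : Type*} [NormedAddCommGroup E] [InnerProductSpace ℝ E] [FiniteDimensional ℝ E]
  [MeasurableSpace E] [BorelSpace E]

/-! ### Tools -/

omit [InnerProductSpace ℝ E] [FiniteDimensional ℝ E] [MeasurableSpace E] [BorelSpace E] in
/-- A product `χ(t) ψ(x)` of a smooth `χ` vanishing off a compact interval `[a, b] ⊆ I` and a
smooth compactly supported `ψ` with `tsupport ψ ⊆ U` is a space–time test function on the open
cylinder `I × U`. [folklore] -/
theorem isSpaceTimeTestOn_prod_mul [NormedSpace ℝ E] {I : Set ℝ} (hI : IsOpen I) {U : Set E}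
    (hU : IsOpen U) {χ : ℝ → ℝ} (hχ : ContDiff ℝ (⊤ : ℕ∞) χ) {a b : ℝ} (hab : Icc a b ⊆ I)
    (hχ0 : ∀ t, t ∉ Icc a b → χ t = 0) {ψ : E → ℝ} (hψ : ContDiff ℝ (⊤ : ℕ∞) ψ)
    (hψc : HasCompactSupport ψ) (hψU : tsupport ψ ⊆ U) :
    IsSpaceTimeTestOn (⟨I ×ˢ U, hI.prod hU⟩ : Opens (ℝ × E)) (fun t x => χ t * ψ x) := by
  have hK : IsCompact (Icc a b ×ˢ tsupport ψ) := isCompact_Icc.prod hψc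
  have hzero : ∀ z : ℝ × E, z ∉ Icc a b ×ˢ tsupport ψ → uncurry (fun t x => χ t * ψ x) z = 0 := by
    rintro ⟨t, x⟩ hz
    rcases not_and_or.1 (fun h => hz (mem_prod.2 h)) with h | h
    · simp [uncurry, hχ0 t h]
    · simp [uncurry, image_eq_zero_of_notMem_tsupport h]
  have hts : tsupport (uncurry fun t x => χ t * ψ x) ⊆ Icc a b ×ˢ tsupport ψ :=
    closure_minimal (fun z hz => by_contra fun h => hz (hzero z h))
      (isClosed_Icc.prod (isClosed_tsupport ψ))
  exact
    { contDiff := (hχ.comp contDiff_fst).mul (hψ.comp contDiff_snd)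
      hasCompactSupport := HasCompactSupport.intro hK hzero
      tsupport_subset := hts.trans (prod_mono hab hψU) }

/-- `∫_K ‖w‖² = (∫⁻_K ‖w‖ₑ²).toReal` for an a.e.-strongly measurable field. [folklore] -/
theorem integral_norm_sq_eq_toReal_lintegral {w : E → E} {K : Set E}
    (hw : AEStronglyMeasurable w (volume.restrict K)) :
    ∫ x in K, ‖w x‖ ^ 2 = (∫⁻ x in K, ‖w x‖ₑ ^ 2).toReal := by
  rw [integral_eq_lintegral_of_nonneg_ae (Eventually.of_forall fun x => sq_nonneg _)
    (hw.norm.aemeasurable.pow_const 2).aestronglyMeasurable]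
  congr 1
  refine lintegral_congr fun x => ?_
  rw [ENNReal.ofReal_pow (norm_nonneg _), ofReal_norm]

/-- **The weighted energy of the slices tends to that of the datum** (a.e. form). If a.e. slice
`u(t)`, `0 < t < T`, is measurable and in `L²(K)`, `u₀ ∈ L²(K)` is measurable,
`∫_K ‖u(t) - u₀‖² → 0` as `t → 0⁺`, and `ψ ≥ 0` is continuous, bounded by `Cψ` and vanishes off
the compact `K`, then for every `ε > 0` there is `τ > 0` with
`|∫ ‖u(t)‖² ψ - ∫ ‖u₀‖² ψ| ≤ ε` for a.e. `t ∈ (0, τ)`: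
`‖a‖² - ‖b‖² = ‖a - b‖² + 2⟪a - b, b⟫` and Cauchy–Schwarz. [folklore] -/
theorem exists_ae_abs_integral_sq_mul_sub_le {T : ℝ} (hT : 0 < T) {K : Set E} (hK : IsCompact K)
    {u : ℝ → E → E} {u₀ : E → E}
    (hgood : ∀ᵐ t ∂((volume : Measure ℝ).restrict (Ioo 0 T)),
      AEStronglyMeasurable (u t) (volume : Measure E) ∧ ∫⁻ x in K, ‖u t x‖ₑ ^ 2 < ∞)
    (hm₀ : AEStronglyMeasurable u₀ (volume : Measure E)) (hu₀ : ∫⁻ x in K, ‖u₀ x‖ₑ ^ 2 < ∞)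
    (h₀ : Tendsto (fun t => ∫⁻ x in K, ‖u t x - u₀ x‖ₑ ^ 2) (𝓝[>] 0) (𝓝 0))
    {ψ : E → ℝ} (hψc : Continuous ψ) (hψ0 : ∀ x, 0 ≤ ψ x) {Cψ : ℝ} (hψC : ∀ x, ψ x ≤ Cψ)
    (hψK : ∀ x, x ∉ K → ψ x = 0) {ε : ℝ} (hε : 0 < ε) :
    ∃ τ > 0, ∀ᵐ t ∂((volume : Measure ℝ).restrict (Ioo 0 τ)),
      |(∫ x, ‖u t x‖ ^ 2 * ψ x) - ∫ x, ‖u₀ x‖ ^ 2 * ψ x| ≤ ε := by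
  have hCψ0 : 0 ≤ Cψ := (hψ0 0).trans (hψC 0)
  have hψabs : ∀ x, ‖ψ x‖ ≤ Cψ := fun x => by
    rw [Real.norm_eq_abs, abs_of_nonneg (hψ0 x)]; exact hψC x
  set μK : Measure E := (volume : Measure E).restrict K with hμK
  haveI : IsFiniteMeasure μK :=
    ⟨by rw [hμK, Measure.restrict_apply_univ]; exact hK.measure_lt_top⟩
  have hKm : MeasurableSet K := hK.measurableSet
  -- the datum in `L²(K)`
  have hm₀K : MemLp u₀ 2 μK := memLp_two_restrict_of_lintegral_lt_top hm₀ hu₀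
  set b : ℝ := (∫ x in K, ‖u₀ x‖ ^ 2) ^ (1 / 2 : ℝ) with hb
  have hI₀ : 0 ≤ ∫ x in K, ‖u₀ x‖ ^ 2 := integral_nonneg fun x => sq_nonneg _
  have hb0 : 0 ≤ b := Real.rpow_nonneg hI₀ _
  -- the bounding function of `d(t) = ∫_K ‖u(t) - u₀‖²`
  set d : ℝ → ℝ≥0∞ := fun t => ∫⁻ x in K, ‖u t x - u₀ x‖ₑ ^ 2 with hd
  set Φ : ℝ → ℝ := fun t => Cψ * (d t).toReal + 2 * (Cψ * b) * (d t).toReal ^ (1 / 2 : ℝ)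
    with hΦ
  have hΦlim : Tendsto Φ (𝓝[>] 0) (𝓝 0) := by
    have h1 : Tendsto (fun t => (d t).toReal) (𝓝[>] 0) (𝓝 0) := by
      have := (ENNReal.tendsto_toReal ENNReal.zero_ne_top).comp h₀
      rw [ENNReal.toReal_zero] at this
      exact this
    have h2 : Tendsto (fun t => (d t).toReal ^ (1 / 2 : ℝ)) (𝓝[>] 0) (𝓝 0) := by
      have := h1.rpow_const (p := 1 / 2) (Or.inr (by norm_num))
      rwa [Real.zero_rpow (by norm_num)] at this
    have h3 := (h1.const_mul Cψ).add (h2.const_mul (2 * (Cψ * b)))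
    simpa [hΦ] using h3
  have hev : ∀ᶠ t in 𝓝[>] (0 : ℝ), Φ t < ε := (tendsto_order.1 hΦlim).2 ε hε
  obtain ⟨τ, hτ, hsub⟩ := mem_nhdsGT_iff_exists_Ioo_subset.1 hev
  refine ⟨min τ T, lt_min hτ hT, ?_⟩
  have hgood' : ∀ᵐ t ∂((volume : Measure ℝ).restrict (Ioo 0 (min τ T))),
      (AEStronglyMeasurable (u t) (volume : Measure E) ∧ ∫⁻ x in K, ‖u t x‖ₑ ^ 2 < ∞) ∧
        t ∈ Ioo 0 (min τ T) :=
    (ae_restrict_of_ae_restrict_of_subset (Ioo_subset_Ioo_right (min_le_right _ _)) hgood).and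
      (ae_restrict_mem measurableSet_Ioo)
  filter_upwards [hgood'] with t ⟨⟨hmt, hfin⟩, ht⟩
  have hΦt : Φ t < ε := hsub ⟨ht.1, ht.2.trans_le (min_le_left _ _)⟩
  -- `L²(K)` memberships of the slice
  have h1 : MemLp (u t) 2 μK := memLp_two_restrict_of_lintegral_lt_top hmt hfin
  have h2 : MemLp (fun x => u t x - u₀ x) 2 μK := h1.sub hm₀K
  have hsq1 : Integrable (fun x => ‖u t x‖ ^ 2) μK := (memLp_two_iff_integrable_sq_norm h1.1).1 h1
  have hsq0 : Integrable (fun x => ‖u₀ x‖ ^ 2) μK :=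
    (memLp_two_iff_integrable_sq_norm hm₀K.1).1 hm₀K
  have hsq2 : Integrable (fun x => ‖u t x - u₀ x‖ ^ 2) μK :=
    (memLp_two_iff_integrable_sq_norm h2.1).1 h2
  have hinner : Integrable (fun x => ⟪u t x - u₀ x, u₀ x⟫) μK :=
    FunctionSpaces.integrable_inner_of_eLpNorm_two_lt_top h2.1 hm₀K.1 h2.2 hm₀K.2
  -- from `K` to the whole space (the weight vanishes off `K`)
  have hext : ∀ {g : E → ℝ}, Integrable g μK → Integrable (fun x => g x * ψ x) volume := by
    intro g hg
    have hgK : IntegrableOn (fun x => g x * ψ x) K volume :=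
      hg.mul_bdd hψc.aestronglyMeasurable (Eventually.of_forall hψabs)
    exact hgK.integrable_of_forall_notMem_eq_zero fun x hx => by rw [hψK x hx, mul_zero]
  have hrestr : ∀ g : E → ℝ, ∫ x, g x * ψ x = ∫ x in K, g x * ψ x := fun g =>
    (setIntegral_eq_integral_of_forall_compl_eq_zero fun x hx => by
      rw [hψK x hx, mul_zero]).symm
  -- the algebra `‖a‖² - ‖b‖² = ‖a - b‖² + 2⟪a - b, b⟫`
  have halg : ∀ x, ‖u t x‖ ^ 2 * ψ x - ‖u₀ x‖ ^ 2 * ψ x =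
      ‖u t x - u₀ x‖ ^ 2 * ψ x + 2 * (⟪u t x - u₀ x, u₀ x⟫ * ψ x) := by
    intro x
    have e : u t x = (u t x - u₀ x) + u₀ x := (sub_add_cancel _ _).symm
    conv_lhs => rw [e, norm_add_sq_real]
    ring
  have hdiff : (∫ x, ‖u t x‖ ^ 2 * ψ x) - ∫ x, ‖u₀ x‖ ^ 2 * ψ x =
      (∫ x, ‖u t x - u₀ x‖ ^ 2 * ψ x) + 2 * ∫ x, ⟪u t x - u₀ x, u₀ x⟫ * ψ x := by
    rw [← integral_sub (hext hsq1) (hext hsq0), ← integral_const_mul,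
      ← integral_add (hext hsq2) ((hext hinner).const_mul 2)]
    exact integral_congr_ae (Eventually.of_forall fun x => by dsimp only; rw [halg x])
  -- first term: `0 ≤ ∫ ‖a - b‖² ψ ≤ Cψ d`
  have hA0 : 0 ≤ ∫ x, ‖u t x - u₀ x‖ ^ 2 * ψ x :=
    integral_nonneg fun x => mul_nonneg (sq_nonneg _) (hψ0 x)
  have hdK : ∫ x in K, ‖u t x - u₀ x‖ ^ 2 = (d t).toReal :=
    integral_norm_sq_eq_toReal_lintegral h2.1
  have hA : ∫ x, ‖u t x - u₀ x‖ ^ 2 * ψ x ≤ Cψ * (d t).toReal := by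
    rw [hrestr, ← hdK, ← integral_const_mul]
    refine integral_mono_ae (hsq2.mul_bdd hψc.aestronglyMeasurable (Eventually.of_forall hψabs))
      (hsq2.const_mul Cψ) (Eventually.of_forall fun x => ?_)
    show ‖u t x - u₀ x‖ ^ 2 * ψ x ≤ Cψ * ‖u t x - u₀ x‖ ^ 2
    rw [mul_comm]
    exact mul_le_mul_of_nonneg_right (hψC x) (sq_nonneg _)
  -- second term: Cauchy–Schwarz
  have hB : |∫ x, ⟪u t x - u₀ x, u₀ x⟫ * ψ x| ≤ (d t).toReal ^ (1 / 2 : ℝ) * (Cψ * b) := by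
    rw [hrestr]
    have hg2 : MemLp (fun x => ψ x * ‖u₀ x‖) 2 μK := by
      refine (hm₀K.norm.const_mul Cψ).of_le (hψc.aestronglyMeasurable.mul hm₀K.1.norm) ?_
      refine Eventually.of_forall fun x => ?_
      rw [norm_mul, norm_mul, Real.norm_of_nonneg hCψ0]
      exact mul_le_mul_of_nonneg_right (hψabs x) (norm_nonneg _)
    have hf2 : MemLp (fun x => ‖u t x - u₀ x‖) 2 μK := h2.norm
    have hf2' : MemLp (fun x => ‖u t x - u₀ x‖) (ENNReal.ofReal 2) μK := by
      rwa [ENNReal.ofReal_ofNat]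
    have hg2' : MemLp (fun x => ψ x * ‖u₀ x‖) (ENNReal.ofReal 2) μK := by
      rwa [ENNReal.ofReal_ofNat]
    have hCS := integral_mul_le_Lp_mul_Lq_of_nonneg (μ := μK) Real.HolderConjugate.two_two
      (Eventually.of_forall fun x => norm_nonneg (u t x - u₀ x))
      (Eventually.of_forall fun x => mul_nonneg (hψ0 x) (norm_nonneg (u₀ x))) hf2' hg2'
    have hle1 : |∫ x in K, ⟪u t x - u₀ x, u₀ x⟫ * ψ x| ≤
        ∫ x in K, ‖u t x - u₀ x‖ * (ψ x * ‖u₀ x‖) := by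
      refine abs_integral_le_integral_abs.trans (integral_mono_ae
        ((hinner.mul_bdd hψc.aestronglyMeasurable (Eventually.of_forall hψabs)).abs)
        (memLp_one_iff_integrable.1 (hg2.mul' hf2)) (Eventually.of_forall fun x => ?_))
      show |⟪u t x - u₀ x, u₀ x⟫ * ψ x| ≤ ‖u t x - u₀ x‖ * (ψ x * ‖u₀ x‖)
      rw [abs_mul, abs_of_nonneg (hψ0 x)]
      calc |⟪u t x - u₀ x, u₀ x⟫| * ψ x ≤ (‖u t x - u₀ x‖ * ‖u₀ x‖) * ψ x :=
            mul_le_mul_of_nonneg_right (abs_real_inner_le_norm _ _) (hψ0 x)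
        _ = ‖u t x - u₀ x‖ * (ψ x * ‖u₀ x‖) := by ring
    have hI1 : (∫ x in K, ‖u t x - u₀ x‖ ^ (2 : ℝ)) ^ (1 / 2 : ℝ) =
        (d t).toReal ^ (1 / 2 : ℝ) := by
      rw [← hdK]
      congr 1
      exact integral_congr_ae (Eventually.of_forall fun x => by dsimp only; rw [Real.rpow_two])
    have hI2 : (∫ x in K, (ψ x * ‖u₀ x‖) ^ (2 : ℝ)) ^ (1 / 2 : ℝ) ≤ Cψ * b := by
      have hmono : ∫ x in K, (ψ x * ‖u₀ x‖) ^ (2 : ℝ) ≤ ∫ x in K, Cψ ^ 2 * ‖u₀ x‖ ^ 2 := by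
        refine integral_mono_ae ?_ (hsq0.const_mul _) (Eventually.of_forall fun x => ?_)
        · have := (memLp_two_iff_integrable_sq_norm hg2.1).1 hg2
          refine this.congr (Eventually.of_forall fun x => ?_)
          dsimp only
          rw [Real.norm_of_nonneg (mul_nonneg (hψ0 x) (norm_nonneg _)), Real.rpow_two]
        · dsimp only
          rw [Real.rpow_two, mul_pow]
          exact mul_le_mul_of_nonneg_right (pow_le_pow_left₀ (hψ0 x) (hψC x) 2) (sq_nonneg _)
      have hnn : 0 ≤ ∫ x in K, (ψ x * ‖u₀ x‖) ^ (2 : ℝ) :=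
        integral_nonneg fun x => Real.rpow_nonneg (mul_nonneg (hψ0 x) (norm_nonneg _)) _
      calc (∫ x in K, (ψ x * ‖u₀ x‖) ^ (2 : ℝ)) ^ (1 / 2 : ℝ)
          ≤ (∫ x in K, Cψ ^ 2 * ‖u₀ x‖ ^ 2) ^ (1 / 2 : ℝ) :=
            Real.rpow_le_rpow hnn hmono (by norm_num)
        _ = (Cψ ^ 2 * ∫ x in K, ‖u₀ x‖ ^ 2) ^ (1 / 2 : ℝ) := by rw [integral_const_mul]
        _ = Cψ * b := by
            rw [Real.mul_rpow (sq_nonneg _) hI₀, hb]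
            congr 1
            rw [← Real.sqrt_eq_rpow, Real.sqrt_sq hCψ0]
    calc |∫ x in K, ⟪u t x - u₀ x, u₀ x⟫ * ψ x|
        ≤ ∫ x in K, ‖u t x - u₀ x‖ * (ψ x * ‖u₀ x‖) := hle1
      _ ≤ _ := hCS
      _ ≤ (d t).toReal ^ (1 / 2 : ℝ) * (Cψ * b) := by
          rw [hI1]
          exact mul_le_mul_of_nonneg_left hI2 (Real.rpow_nonneg ENNReal.toReal_nonneg _)
  calc |(∫ x, ‖u t x‖ ^ 2 * ψ x) - ∫ x, ‖u₀ x‖ ^ 2 * ψ x|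
      = |(∫ x, ‖u t x - u₀ x‖ ^ 2 * ψ x) + 2 * ∫ x, ⟪u t x - u₀ x, u₀ x⟫ * ψ x| := by rw [hdiff]
    _ ≤ |∫ x, ‖u t x - u₀ x‖ ^ 2 * ψ x| + 2 * |∫ x, ⟪u t x - u₀ x, u₀ x⟫ * ψ x| := by
        refine (abs_add_le _ _).trans ?_
        rw [abs_mul, abs_two]
    _ ≤ Cψ * (d t).toReal + 2 * ((d t).toReal ^ (1 / 2 : ℝ) * (Cψ * b)) := by
        rw [abs_of_nonneg hA0]
        gcongr
    _ = Φ t := by simp only [hΦ]; ring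
    _ ≤ ε := hΦt.le

/-! ### The local energy inequality from the initial time, sliced -/

/-- **The local energy inequality of a local Leray solution from the initial time, at a.e.
slice** (the a.e.-in-time form of "`limsup_{t→0⁺} ∫ |v(t)|² ψ ≤ ∫ |v₀|² ψ` from the local energy
inequality up to `t = 0`", Lemarié-Rieusset 2016, Prop. 14.1; Bradshaw–Tsai 2019, §4.3: "For
compact subsets `K` of `B₁`, we automatically have `lim_{t→0⁺} ‖v − v₀‖_{L²(K)} = 0`"). Let
`(v, π)` be a local Leray solution (`ν = 1`) with measurable datum `v₀`, let `ψ ≥ 0` be smooth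
with `tsupport ψ ⊆ B_r`, and assume `|v|³ ∈ L¹((0,T₀) × B_r)`. Then for a.e. `s ∈ (0, T₀/2)`,
`∫ |v(s)|² ψ ≤ ∫ |v₀|² ψ + ∫∫_{(0,s)×B_r} | |v|² Δψ + (|v|² + 2π) v·∇ψ |`.
Proof: the sliced local energy inequality (`ae_localEnergy_slice_ennreal`, CKN (2.5)) on the
cylinder `(0,T₀) × B_r` tested with `η_δ(t) θ(t) ψ(x)` — `η_δ` a monotone cut-off vanishing near
`t = 0` with `η_δ' = ρ_δ` a unit-mass kernel in `(δ, 3δ)`, `θ` a plateau `≡ 1` on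
`[-1, 5T₀/8]` —, so that `∫∫ ρ_δ |v|² ψ → ∫ |v₀|² ψ` as `δ → 0` by the initial condition
(`tendsto_setIntegral_mul_of_ae_tendsto`). [cite: LemarieRieusset2016, Prop. 14.1; BradshawTsai2019 §4.3 (proof of Thm 1.2)] -/
theorem _root_.Literature.Analysis.FluidPDE.IsLocalLeraySolution.ae_lintegral_sq_mul_le_datum_add
    {v₀ : (EuclideanSpace ℝ (Fin 3)) → (EuclideanSpace ℝ (Fin 3))} {v : ℝ → (EuclideanSpace ℝ (Fin 3)) → (EuclideanSpace ℝ (Fin 3))} {π : ℝ → (EuclideanSpace ℝ (Fin 3)) → ℝ}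
    (h : IsLocalLeraySolution 1 v₀ v π) (hm₀ : AEStronglyMeasurable v₀ volume)
    {r T₀ : ℝ} (hT₀ : 0 < T₀)
    (hu3 : IntegrableOn (fun z : ℝ × (EuclideanSpace ℝ (Fin 3)) => ‖v z.1 z.2‖ ^ 3) (Ioo 0 T₀ ×ˢ ball (0 : (EuclideanSpace ℝ (Fin 3))) r) volume)
    {ψ : (EuclideanSpace ℝ (Fin 3)) → ℝ} (hψ : ContDiff ℝ (⊤ : ℕ∞) ψ) (hψs : tsupport ψ ⊆ ball 0 r)
    (hψ0 : ∀ x, 0 ≤ ψ x) :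
    ∀ᵐ s ∂(volume.restrict (Ioo 0 (T₀ / 2))),
      ∫⁻ x, ‖v s x‖ₑ ^ 2 * ENNReal.ofReal (ψ x) ≤
        (∫⁻ x, ‖v₀ x‖ₑ ^ 2 * ENNReal.ofReal (ψ x)) +
        ∫⁻ z in Ioo 0 s ×ˢ ball (0 : (EuclideanSpace ℝ (Fin 3))) r,
          ‖‖v z.1 z.2‖ ^ 2 * Δ ψ z.2 +
            (‖v z.1 z.2‖ ^ 2 + 2 * π z.1 z.2) * ⟪v z.1 z.2, gradient ψ z.2⟫‖ₑ := by
  -- the flux integrand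
  set R₀ : ℝ × (EuclideanSpace ℝ (Fin 3)) → ℝ := fun z => ‖v z.1 z.2‖ ^ 2 * Δ ψ z.2 +
    (‖v z.1 z.2‖ ^ 2 + 2 * π z.1 z.2) * ⟪v z.1 z.2, gradient ψ z.2⟫ with hR₀
  -- the compact shadow of `ψ`
  set K : Set (EuclideanSpace ℝ (Fin 3)) := closedBall 0 r with hKdef
  have hK : IsCompact K := isCompact_closedBall 0 r
  have hψK : ∀ x, x ∉ K → ψ x = 0 := fun x hx =>
    image_eq_zero_of_notMem_tsupport fun h' => hx (ball_subset_closedBall (hψs h'))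
  have hψcs : HasCompactSupport ψ := HasCompactSupport.intro hK hψK
  obtain ⟨Cψ, hCψ⟩ := hψ.continuous.bounded_above_of_compact_support hψcs
  have hψC : ∀ x, ψ x ≤ Cψ := fun x => (le_abs_self _).trans (by simpa using hCψ x)
  have hψ2 : ContDiff ℝ 2 ψ := contDiff_infty.1 hψ 2
  have hψd : Differentiable ℝ ψ := hψ.differentiable (by simp)
  have hΔ0 : ∀ x, x ∉ ball (0 : (EuclideanSpace ℝ (Fin 3))) r → Δ ψ x = 0 := fun x hx =>
    laplacian_eq_zero_of_notMem_tsupport fun h' => hx (hψs h')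
  have hgrad0 : ∀ x, x ∉ ball (0 : (EuclideanSpace ℝ (Fin 3))) r → gradient ψ x = 0 := fun x hx => by
    have : fderiv ℝ ψ x = 0 := fderiv_of_notMem_tsupport ℝ fun h' => hx (hψs h')
    simp [gradient, this]
  have hR₀0 : ∀ z : ℝ × (EuclideanSpace ℝ (Fin 3)), z.2 ∉ ball (0 : (EuclideanSpace ℝ (Fin 3))) r → R₀ z = 0 := fun z hz => by
    simp only [hR₀, hΔ0 z.2 hz, hgrad0 z.2 hz, inner_zero_right, mul_zero, add_zero]
  -- the region `Q = (0,T₀) × B_r` and the solution on it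
  let Q : Opens (ℝ × (EuclideanSpace ℝ (Fin 3))) := ⟨Ioo 0 T₀ ×ˢ ball (0 : (EuclideanSpace ℝ (Fin 3))) r, isOpen_Ioo.prod isOpen_ball⟩
  have hQle : Q ≤ slab (EuclideanSpace ℝ (Fin 3)) (Ioi 0) isOpen_Ioi := fun z hz =>
    mem_slab.2 (show z ∈ Ioo (0 : ℝ) T₀ ×ˢ ball (0 : (EuclideanSpace ℝ (Fin 3))) r from hz).1.1
  have hsuit : IsSuitableWeakSolutionOn Q 1 0 v π := h.suitable.of_le hQle
  obtain ⟨G, hG, -⟩ := h.uniformLocalGradient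
  have hGQ : HasWeakSpatialGradientOn Q v G := hG.mono hQle
  have hu3' : LocallyIntegrableOn (fun z : ℝ × (EuclideanSpace ℝ (Fin 3)) => ‖v z.1 z.2‖ ^ 3) (Q : Set (ℝ × (EuclideanSpace ℝ (Fin 3))))
      volume := hu3.locallyIntegrableOn
  have hfu : LocallyIntegrableOn (fun z : ℝ × (EuclideanSpace ℝ (Fin 3)) => ⟪(0 : ℝ → (EuclideanSpace ℝ (Fin 3)) → (EuclideanSpace ℝ (Fin 3))) z.1 z.2, v z.1 z.2⟫)
      (Q : Set (ℝ × (EuclideanSpace ℝ (Fin 3)))) volume := by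
    simp only [Pi.zero_apply, inner_zero_left]
    exact (locallyIntegrable_const (0 : ℝ)).locallyIntegrableOn _
  -- integrability of `v`, `|v|²` on `(0,T₀) × K`, good slices, the datum in `L²(K)`
  have hmeas : AEStronglyMeasurable (uncurry v)
      ((volume : Measure (ℝ × (EuclideanSpace ℝ (Fin 3)))).restrict (Ioo 0 T₀ ×ˢ univ)) :=
    h.aestronglyMeasurable.mono_measure
      (Measure.restrict_mono (Set.prod_mono Ioo_subset_Ioi_self Subset.rfl) le_rfl)
  have hsq : ∀ K' : Set (EuclideanSpace ℝ (Fin 3)), IsCompact K' → ∫⁻ z in Ioo 0 T₀ ×ˢ K', ‖uncurry v z‖ₑ ^ 2 < ∞ :=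
    fun K' hK' => h.sqIntegrable T₀ hT₀ K' hK'
  obtain ⟨hvK1, hvK2⟩ := integrableOn_cylinder_of_lintegral_sq_slab hmeas hsq hK
  have hgood := ae_slice_aestronglyMeasurable_and_lintegral_ball_lt_top hmeas hsq
  have hgoodK : ∀ᵐ t ∂((volume : Measure ℝ).restrict (Ioo 0 T₀)),
      AEStronglyMeasurable (v t) (volume : Measure (EuclideanSpace ℝ (Fin 3))) ∧ ∫⁻ x in K, ‖v t x‖ₑ ^ 2 < ∞ := by
    filter_upwards [hgood] with t ht
    exact ⟨ht.1, (lintegral_mono_set (closedBall_subset_closedBall (Nat.le_ceil r))).trans_lt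
      (ht.2 ⌈r⌉₊)⟩
  have hv₀K : ∫⁻ x in K, ‖v₀ x‖ₑ ^ 2 < ∞ :=
    lintegral_datum_sq_lt_top hT₀ hgoodK hm₀ (h.initial K hK)
  -- the sliced weighted energy `U` and its limit `L` at `0⁺`
  set U : ℝ → ℝ := fun t => ∫ x, ‖v t x‖ ^ 2 * ψ x with hU
  set L : ℝ := ∫ x, ‖v₀ x‖ ^ 2 * ψ x with hL
  have hWint : Integrable (fun z : ℝ × (EuclideanSpace ℝ (Fin 3)) => ‖uncurry v z‖ ^ 2 * ψ z.2)
      (((volume : Measure ℝ).restrict (Ioo 0 T₀)).prod (volume : Measure (EuclideanSpace ℝ (Fin 3)))) :=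
    integrable_slab_mul hK hvK2 (hψ.continuous.comp continuous_snd) fun t x hx => hψK x hx
  have hUint : IntegrableOn U (Ioo 0 T₀) volume := hWint.integral_prod_left
  have hlim : ∀ ε > 0, ∃ τ > 0, ∀ᵐ t ∂((volume : Measure ℝ).restrict (Ioo 0 τ)),
      |U t - L| ≤ ε := fun ε hε =>
    exists_ae_abs_integral_sq_mul_sub_le hT₀ hK hgoodK hm₀ hv₀K (h.initial K hK) hψ.continuous
      hψ0 hψC hψK hε
  -- bottom cut-offs at scale `δ m`
  set δ : ℕ → ℝ := fun m => T₀ / (8 * ((m : ℝ) + 1)) with hδ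
  have hδ0 : ∀ m, 0 < δ m := fun m => by positivity
  have hδle : ∀ m, δ m ≤ T₀ / 8 := fun m => by
    show T₀ / (8 * ((m : ℝ) + 1)) ≤ T₀ / 8
    exact div_le_div_of_nonneg_left hT₀.le (by norm_num) (by nlinarith [m.cast_nonneg (α := ℝ)])
  have hδT : ∀ m, 3 * δ m ≤ T₀ := fun m => by linarith [hδle m]
  have hδlim : Tendsto δ atTop (𝓝 0) := by
    have h1 : Tendsto (fun m : ℕ => (m : ℝ) + 1) atTop atTop :=
      tendsto_atTop_add_const_right _ 1 tendsto_natCast_atTop_atTop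
    have h2 : Tendsto (fun m : ℕ => 8 * ((m : ℝ) + 1)) atTop atTop :=
      h1.const_mul_atTop (by norm_num)
    exact tendsto_const_nhds.div_atTop h2
  choose η ρ hηs hρc hηρ hη0 hη1 hη01 hρ0 hρsupp hρ1 using fun m => exists_smooth_time_cutoff (hδ0 m)
  have hηabs : ∀ m s, |η m s| ≤ 1 := fun m s => by
    rw [abs_le]; exact ⟨by linarith [(hη01 m s).1], (hη01 m s).2⟩
  have hρC : ∀ m, ∃ C, 0 ≤ C ∧ ∀ s, |ρ m s| ≤ C := fun m =>
    exists_abs_le_of_eq_zero_off_Ioo (hρc m) (hρsupp m)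
  -- the top plateau `θ ≡ 1` on `[-1, 5T₀/8]`, supported in `(-1 - T₀/8, 6T₀/8)`
  let θ : ContDiffBump ((5 * T₀ / 8 - 1) / 2 : ℝ) :=
    ⟨(5 * T₀ / 8 + 1) / 2, (5 * T₀ / 8 + 1) / 2 + T₀ / 8, by positivity, by linarith⟩
  have hθrIn : θ.rIn = (5 * T₀ / 8 + 1) / 2 := rfl
  have hθrOut : θ.rOut = (5 * T₀ / 8 + 1) / 2 + T₀ / 8 := rfl
  have hθ1 : ∀ t ∈ Icc (-1 : ℝ) (5 * T₀ / 8), (θ : ℝ → ℝ) t = 1 := fun t ht =>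
    θ.one_of_mem_closedBall (by
      rw [mem_closedBall, Real.dist_eq, hθrIn, abs_le]; constructor <;> linarith [ht.1, ht.2])
  have hθ0 : ∀ t, t ∉ Icc (-1 - T₀ / 8) (6 * T₀ / 8) → (θ : ℝ → ℝ) t = 0 := fun t ht => by
    by_contra hne
    have hmem : t ∈ support (θ : ℝ → ℝ) := hne
    rw [θ.support_eq, mem_ball, Real.dist_eq, hθrOut, abs_lt] at hmem
    exact ht ⟨by linarith [hmem.1], by linarith [hmem.2]⟩
  have hθderiv : ∀ t ∈ Ioo (-1 : ℝ) (5 * T₀ / 8), deriv (θ : ℝ → ℝ) t = 0 := fun t ht => by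
    have : (θ : ℝ → ℝ) =ᶠ[𝓝 t] fun _ => (1 : ℝ) := by
      filter_upwards [Ioo_mem_nhds ht.1 ht.2] with s hs using hθ1 s (Ioo_subset_Icc_self hs)
    rw [this.deriv_eq, deriv_const]
  -- the test functions `ξ = θ ψ` and `ζ m = η m ξ`
  set ξ : ℝ → (EuclideanSpace ℝ (Fin 3)) → ℝ := fun t x => (θ : ℝ → ℝ) t * ψ x with hξ
  have hξtest : IsSpaceTimeTestOn (⊤ : Opens (ℝ × (EuclideanSpace ℝ (Fin 3)))) ξ :=
    (isSpaceTimeTestOn_prod_mul isOpen_univ isOpen_univ θ.contDiff (subset_univ _) hθ0 hψ hψcs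
      (subset_univ _)).mono le_top
  set ζ : ℕ → ℝ → (EuclideanSpace ℝ (Fin 3)) → ℝ := fun m t x => η m t * ξ t x with hζ
  have hζtest : ∀ m, IsSpaceTimeTestOn Q (ζ m) := by
    intro m
    have e : ζ m = fun t x => (η m t * (θ : ℝ → ℝ) t) * ψ x := by
      funext t x; simp only [hζ, hξ]; ring
    rw [e]
    refine isSpaceTimeTestOn_prod_mul isOpen_Ioo isOpen_ball ((hηs m).mul θ.contDiff)
      (a := δ m) (b := 6 * T₀ / 8) (Icc_subset_Ioo (hδ0 m) (by linarith)) ?_ hψ hψcs hψs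
    intro t ht
    by_cases h1 : t ≤ δ m
    · rw [hη0 m t h1, zero_mul]
    · have : t ∉ Icc (-1 - T₀ / 8) (6 * T₀ / 8) := fun h' =>
        ht ⟨(not_le.1 h1).le, h'.2⟩
      rw [hθ0 t this, mul_zero]
  have hζ0 : ∀ m t x, 0 ≤ ζ m t x := fun m t x =>
    mul_nonneg (hη01 m t).1 (mul_nonneg (θ.nonneg) (hψ0 x))
  -- `R[ξ] = R₀` on `(0, 5T₀/8) × (EuclideanSpace ℝ (Fin 3))`
  have hRξ : ∀ z : ℝ × (EuclideanSpace ℝ (Fin 3)), z.1 ∈ Ioo (0 : ℝ) (5 * T₀ / 8) →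
      localEnergyRHS 1 0 v π ξ z = R₀ z := by
    rintro ⟨t, x⟩ ht
    have hθt : (θ : ℝ → ℝ) t = 1 := hθ1 t ⟨by linarith [ht.1], ht.2.le⟩
    have htd : timeDeriv ξ t x = 0 := by
      simp only [timeDeriv, hξ]
      rw [deriv_mul_const ((θ.contDiff (n := (⊤ : ℕ∞))).differentiable (by simp)).differentiableAt,
        hθderiv t ⟨by linarith [ht.1], ht.2⟩, zero_mul]
    have hΔ : Δ (ξ t) x = (θ : ℝ → ℝ) t * Δ ψ x := by
      have := laplacian_fun_const_smul hψ2 ((θ : ℝ → ℝ) t) x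
      simpa only [smul_eq_mul] using this
    have hgradξ : gradient (ξ t) x = (θ : ℝ → ℝ) t • gradient ψ x := by
      have := gradient_fun_const_smul (hψd x) ((θ : ℝ → ℝ) t)
      simpa only [smul_eq_mul] using this
    simp only [localEnergyRHS, hR₀, htd, hΔ, hgradξ, hθt, Pi.zero_apply, inner_zero_left, one_mul,
      one_smul, zero_add, mul_zero, zero_mul, add_zero]
  -- integrability of the kernel term `ρ(t) |v|² ξ`
  have hI2 : ∀ m, Integrable (fun z : ℝ × (EuclideanSpace ℝ (Fin 3)) => ρ m z.1 * (‖v z.1 z.2‖ ^ 2 * ξ z.1 z.2))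
      (volume : Measure (ℝ × (EuclideanSpace ℝ (Fin 3)))) := by
    intro m
    obtain ⟨C, -, hC⟩ := hρC m
    have hθb : ∀ s, |ρ m s * (θ : ℝ → ℝ) s| ≤ C := fun s => by
      rw [abs_mul, abs_of_nonneg θ.nonneg]
      exact (mul_le_of_le_one_right (abs_nonneg _) θ.le_one).trans (hC s)
    have h1 : Integrable (fun z : ℝ × (EuclideanSpace ℝ (Fin 3)) => (ρ m z.1 * (θ : ℝ → ℝ) z.1) *
        (‖uncurry v z‖ ^ 2 * ψ z.2))
        (((volume : Measure ℝ).restrict (Ioo 0 T₀)).prod (volume : Measure (EuclideanSpace ℝ (Fin 3)))) :=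
      integrable_time_mul hWint ((hρc m).mul θ.continuous) hθb
    rw [← volume_restrict_slab_eq] at h1
    have h1' : IntegrableOn (fun z : ℝ × (EuclideanSpace ℝ (Fin 3)) => (ρ m z.1 * (θ : ℝ → ℝ) z.1) *
        (‖uncurry v z‖ ^ 2 * ψ z.2)) (Ioo 0 T₀ ×ˢ univ) volume := h1
    have h2 := h1'.integrable_of_forall_notMem_eq_zero (fun z hz => by
      have hz1 : z.1 ∉ Ioo (δ m) (3 * δ m) := fun h' =>
        hz ⟨⟨(hδ0 m).trans h'.1, h'.2.trans_le (hδT m)⟩, mem_univ _⟩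
      rw [hρsupp m z.1 hz1, zero_mul, zero_mul])
    refine h2.congr (Eventually.of_forall fun z => ?_)
    simp only [hξ, uncurry]
    ring
  -- integrability of `R[ζ m]` and of `η R[ξ] = R[ζ m] - ρ |v|² ξ`
  have hIR : ∀ m, Integrable (localEnergyRHS 1 0 v π (ζ m)) (volume : Measure (ℝ × (EuclideanSpace ℝ (Fin 3)))) :=
    fun m => hsuit.integrable_localEnergyRHS hu3' hfu (hζtest m)
  have hdec : ∀ m (z : ℝ × (EuclideanSpace ℝ (Fin 3))), localEnergyRHS 1 0 v π (ζ m) z =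
      η m z.1 * localEnergyRHS 1 0 v π ξ z + ρ m z.1 * (‖v z.1 z.2‖ ^ 2 * ξ z.1 z.2) := by
    rintro m ⟨t, x⟩
    exact localEnergyRHS_mul_of_hasDerivAt (ν := 1) (f := 0) (u := v) (p := π) hξtest (hηρ m) t x
  have hI1 : ∀ m, Integrable (fun z : ℝ × (EuclideanSpace ℝ (Fin 3)) => η m z.1 * localEnergyRHS 1 0 v π ξ z)
      (volume : Measure (ℝ × (EuclideanSpace ℝ (Fin 3)))) := by
    intro m
    refine ((hIR m).sub (hI2 m)).congr (Eventually.of_forall fun z => ?_)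
    simp only [Pi.sub_apply, hdec m z]
    ring
  -- the kernel term is `∫ ρ U`
  have hker : ∀ m, ∀ s, 3 * δ m < s →
      ∫ z in {z : ℝ × (EuclideanSpace ℝ (Fin 3)) | z.1 < s}, ρ m z.1 * (‖v z.1 z.2‖ ^ 2 * ξ z.1 z.2) =
        ∫ t in Ioo 0 T₀, ρ m t * U t := by
    intro m s hs
    -- the integrand vanishes for `t ≥ s` and equals `ρ(t) |v|² ψ` everywhere
    have hptw : ∀ z : ℝ × (EuclideanSpace ℝ (Fin 3)), ρ m z.1 * (‖v z.1 z.2‖ ^ 2 * ξ z.1 z.2) =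
        ρ m z.1 * (‖uncurry v z‖ ^ 2 * ψ z.2) := by
      intro z
      by_cases hz : z.1 ∈ Ioo (δ m) (3 * δ m)
      · have hθz : (θ : ℝ → ℝ) z.1 = 1 :=
          hθ1 z.1 ⟨by linarith [hz.1, hδ0 m], by linarith [hz.2, hδle m]⟩
        simp only [hξ, hθz, one_mul, uncurry]
      · rw [hρsupp m z.1 hz, zero_mul, zero_mul]
    rw [setIntegral_eq_integral_of_forall_compl_eq_zero (fun z hz => by
      have hz' : s ≤ z.1 := not_lt.1 hz
      have : z.1 ∉ Ioo (δ m) (3 * δ m) := fun h' => by linarith [h'.2]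
      rw [hρsupp m z.1 this, zero_mul])]
    simp_rw [hptw]
    obtain ⟨C, -, hC⟩ := hρC m
    have hint : Integrable (fun z : ℝ × (EuclideanSpace ℝ (Fin 3)) => ρ m z.1 * (‖uncurry v z‖ ^ 2 * ψ z.2))
        (((volume : Measure ℝ).restrict (Ioo 0 T₀)).prod (volume : Measure (EuclideanSpace ℝ (Fin 3)))) :=
      integrable_time_mul hWint (hρc m) hC
    have hzero : ∀ z : ℝ × (EuclideanSpace ℝ (Fin 3)), z ∉ Ioo 0 T₀ ×ˢ (univ : Set (EuclideanSpace ℝ (Fin 3))) →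
        ρ m z.1 * (‖uncurry v z‖ ^ 2 * ψ z.2) = 0 := fun z hz => by
      have : z.1 ∉ Ioo (δ m) (3 * δ m) := fun h' =>
        hz ⟨⟨(hδ0 m).trans h'.1, h'.2.trans_le (hδT m)⟩, mem_univ _⟩
      rw [hρsupp m z.1 this, zero_mul]
    rw [← setIntegral_eq_integral_of_forall_compl_eq_zero hzero, volume_restrict_slab_eq,
      integral_prod _ hint]
    refine setIntegral_congr_fun measurableSet_Ioo fun t _ => ?_
    simp only [hU, uncurry, ← integral_const_mul]
  -- the transport term is bounded by the flux over `(0,s) × B_r`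
  have hflux : ∀ m, ∀ s ∈ Ioo (0 : ℝ) (T₀ / 2),
      ENNReal.ofReal (∫ z in {z : ℝ × (EuclideanSpace ℝ (Fin 3)) | z.1 < s}, η m z.1 * localEnergyRHS 1 0 v π ξ z) ≤
        ∫⁻ z in Ioo 0 s ×ˢ ball (0 : (EuclideanSpace ℝ (Fin 3))) r, ‖R₀ z‖ₑ := by
    intro m s hs
    have hSm : MeasurableSet (Ioo 0 s ×ˢ ball (0 : (EuclideanSpace ℝ (Fin 3))) r) := measurableSet_Ioo.prod measurableSet_ball
    calc ENNReal.ofReal (∫ z in {z : ℝ × (EuclideanSpace ℝ (Fin 3)) | z.1 < s}, η m z.1 * localEnergyRHS 1 0 v π ξ z)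
        ≤ ‖∫ z in {z : ℝ × (EuclideanSpace ℝ (Fin 3)) | z.1 < s}, η m z.1 * localEnergyRHS 1 0 v π ξ z‖ₑ := by
          rw [Real.enorm_eq_ofReal_abs]
          exact ENNReal.ofReal_le_ofReal (le_abs_self _)
      _ ≤ ∫⁻ z in {z : ℝ × (EuclideanSpace ℝ (Fin 3)) | z.1 < s}, ‖η m z.1 * localEnergyRHS 1 0 v π ξ z‖ₑ :=
          enorm_integral_le_lintegral_enorm _
      _ ≤ ∫⁻ z in {z : ℝ × (EuclideanSpace ℝ (Fin 3)) | z.1 < s},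
            (Ioo 0 s ×ˢ ball (0 : (EuclideanSpace ℝ (Fin 3))) r).indicator (fun z => ‖R₀ z‖ₑ) z := by
          refine lintegral_mono_ae ?_
          filter_upwards [ae_restrict_mem (measurableSet_lt measurable_fst measurable_const)]
            with z hz
          have hzs : z.1 < s := hz
          by_cases h1 : z.1 ≤ δ m
          · rw [hη0 m z.1 h1, zero_mul, enorm_zero]
            exact zero_le
          · have hz0 : 0 < z.1 := (hδ0 m).trans (not_le.1 h1)
            have hzI : z.1 ∈ Ioo (0 : ℝ) (5 * T₀ / 8) := ⟨hz0, by linarith [hs.2]⟩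
            rw [hRξ z hzI]
            by_cases h2 : z.2 ∈ ball (0 : (EuclideanSpace ℝ (Fin 3))) r
            · rw [indicator_of_mem (show z ∈ Ioo 0 s ×ˢ ball (0 : (EuclideanSpace ℝ (Fin 3))) r from ⟨⟨hz0, hzs⟩, h2⟩),
                enorm_mul]
              calc ‖η m z.1‖ₑ * ‖R₀ z‖ₑ ≤ 1 * ‖R₀ z‖ₑ := by
                    gcongr
                    rw [Real.enorm_eq_ofReal_abs, ← ENNReal.ofReal_one]
                    exact ENNReal.ofReal_le_ofReal (hηabs m z.1)
                _ = ‖R₀ z‖ₑ := one_mul _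
            · rw [hR₀0 z h2, mul_zero, enorm_zero]
              exact zero_le
      _ ≤ ∫⁻ z, (Ioo 0 s ×ˢ ball (0 : (EuclideanSpace ℝ (Fin 3))) r).indicator (fun z => ‖R₀ z‖ₑ) z :=
          lintegral_mono' Measure.restrict_le_self le_rfl
      _ = ∫⁻ z in Ioo 0 s ×ˢ ball (0 : (EuclideanSpace ℝ (Fin 3))) r, ‖R₀ z‖ₑ := lintegral_indicator hSm _
  -- the sliced inequality for each `m`
  have hslice : ∀ m, ∀ᵐ s ∂(volume : Measure ℝ), s ∈ Ioo (3 * δ m) (T₀ / 2) →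
      ∫⁻ x, ‖v s x‖ₑ ^ 2 * ENNReal.ofReal (ψ x) ≤
        ENNReal.ofReal (∫ t in Ioo 0 T₀, ρ m t * U t) +
          ∫⁻ z in Ioo 0 s ×ˢ ball (0 : (EuclideanSpace ℝ (Fin 3))) r, ‖R₀ z‖ₑ := by
    intro m
    filter_upwards [hsuit.ae_localEnergy_slice_ennreal hGQ hu3' hfu (hζtest m) (hζ0 m)
      zero_le_one] with s hs hsI
    have hs0 : 0 < s := lt_trans (by linarith [hδ0 m]) hsI.1
    have hζs : ∀ x, ζ m s x = ψ x := fun x => by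
      simp only [hζ, hξ]
      rw [hη1 m s hsI.1.le, hθ1 s ⟨by linarith, by linarith [hsI.2]⟩, one_mul, one_mul]
    have hLHS : ∫⁻ x, ‖v s x‖ₑ ^ 2 * ENNReal.ofReal (ψ x) ≤
        ENNReal.ofReal (∫ z in {z : ℝ × (EuclideanSpace ℝ (Fin 3)) | z.1 < s}, localEnergyRHS 1 0 v π (ζ m) z) := by
      refine le_trans (le_of_eq (lintegral_congr fun x => by rw [hζs x])) (le_trans le_self_add hs)
    refine hLHS.trans ?_
    have hsplit : ∫ z in {z : ℝ × (EuclideanSpace ℝ (Fin 3)) | z.1 < s}, localEnergyRHS 1 0 v π (ζ m) z =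
        (∫ z in {z : ℝ × (EuclideanSpace ℝ (Fin 3)) | z.1 < s}, η m z.1 * localEnergyRHS 1 0 v π ξ z) +
          ∫ z in {z : ℝ × (EuclideanSpace ℝ (Fin 3)) | z.1 < s}, ρ m z.1 * (‖v z.1 z.2‖ ^ 2 * ξ z.1 z.2) := by
      rw [← integral_add (hI1 m).integrableOn (hI2 m).integrableOn]
      exact integral_congr_ae (Eventually.of_forall fun z => hdec m z)
    rw [hsplit, hker m s hsI.1, add_comm]
    exact (ENNReal.ofReal_add_le).trans (add_le_add le_rfl (hflux m s ⟨hs0, hsI.2⟩))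
  -- assemble over `m` and let `m → ∞`
  have hall := ae_all_iff.2 hslice
  have hB : Tendsto (fun m => ∫ t in Ioo 0 T₀, ρ m t * U t) atTop (𝓝 L) :=
    tendsto_setIntegral_mul_of_ae_tendsto hUint hlim hδlim hδ0 hδT hρc hρ0 hρsupp hρ1
  have hLeq : ENNReal.ofReal L = ∫⁻ x, ‖v₀ x‖ₑ ^ 2 * ENNReal.ofReal (ψ x) := by
    have hsq0 : Integrable (fun x => ‖v₀ x‖ ^ 2) ((volume : Measure (EuclideanSpace ℝ (Fin 3))).restrict K) := by
      have hm : MemLp v₀ 2 ((volume : Measure (EuclideanSpace ℝ (Fin 3))).restrict K) :=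
        memLp_two_restrict_of_lintegral_lt_top hm₀ hv₀K
      exact (memLp_two_iff_integrable_sq_norm hm.1).1 hm
    have hψabs : ∀ x, ‖ψ x‖ ≤ Cψ := hCψ
    have hintK : IntegrableOn (fun x => ‖v₀ x‖ ^ 2 * ψ x) K volume :=
      hsq0.mul_bdd hψ.continuous.aestronglyMeasurable (Eventually.of_forall hψabs)
    have hint : Integrable (fun x => ‖v₀ x‖ ^ 2 * ψ x) (volume : Measure (EuclideanSpace ℝ (Fin 3))) :=
      hintK.integrable_of_forall_notMem_eq_zero fun x hx => by rw [hψK x hx, mul_zero]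
    rw [hL, ofReal_integral_eq_lintegral_ofReal hint
      (Eventually.of_forall fun x => mul_nonneg (sq_nonneg _) (hψ0 x))]
    refine lintegral_congr fun x => ?_
    rw [ENNReal.ofReal_mul (sq_nonneg _), ENNReal.ofReal_pow (norm_nonneg _), ofReal_norm]
  rw [ae_restrict_iff' measurableSet_Ioo]
  filter_upwards [hall] with s hs hsI
  have hev : ∀ᶠ m in atTop, 3 * δ m < s := by
    have h3 : Tendsto (fun m => 3 * δ m) atTop (𝓝 0) := by simpa using hδlim.const_mul 3
    exact (tendsto_order.1 h3).2 _ hsI.1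
  have key : ∀ᶠ m in atTop, ∫⁻ x, ‖v s x‖ₑ ^ 2 * ENNReal.ofReal (ψ x) ≤
      ENNReal.ofReal (∫ t in Ioo 0 T₀, ρ m t * U t) +
        ∫⁻ z in Ioo 0 s ×ˢ ball (0 : (EuclideanSpace ℝ (Fin 3))) r, ‖R₀ z‖ₑ :=
    hev.mono fun m hm => hs m ⟨hm, hsI.2⟩
  have hlimit : Tendsto (fun m => ENNReal.ofReal (∫ t in Ioo 0 T₀, ρ m t * U t) +
      ∫⁻ z in Ioo 0 s ×ˢ ball (0 : (EuclideanSpace ℝ (Fin 3))) r, ‖R₀ z‖ₑ) atTop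
      (𝓝 (ENNReal.ofReal L + ∫⁻ z in Ioo 0 s ×ˢ ball (0 : (EuclideanSpace ℝ (Fin 3))) r, ‖R₀ z‖ₑ)) :=
    ((ENNReal.continuous_ofReal.tendsto L).comp hB).add tendsto_const_nhds
  have := ge_of_tendsto hlimit key
  rwa [hLeq] at this

end Energy

end BradshawTsai2019

end Literature.Analysis.FluidPDE

end
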